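import Literature.Analysis.FluidPDE.StokesTorusFrameBound
import HarnessLib

/-!
# The resolvent `(1 + A)⁻¹ = S ∘ S` of a frame operator `S = (1 + A)^{-1/2}` pinned on an
# eigenbasis

Topic `Literature/Analysis/FluidPDE`; companion of `StokesTorusSqrtResolvent.lean`,
`StokesTorusSemigroupDiagonal.lean` / `StokesTorusSemigroup.lean` (which PRODUCE the frame operator
`S = (1 + A)^{-1/2}` of a non-negative diagonal operator `A = b.diagonalPMap m` together with
`R = S ∘ S = (1 + A)⁻¹` and the two resolvent identities) and of `StokesTorusFrameBound.lean`
(`Torus.repr_apply_of_apply_basis`: the coordinates of an operator acting diagonally on a Hilbert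
basis).  Here the resolvent identities are proved for ANY bounded operator `S` that acts on the
Hilbert basis `b` by `S (b i) = (1 + m i)^{-1/2} b i` (`0 ≤ m i`) — the form in which a frame is
handed over by its action on the eigenbasis (e.g. a `ModelFrame` of the mild Navier–Stokes
formulation), without reference to the existential witnesses of the files above:

* `repr_comp_self_apply_of_apply_basis` — `⟪b i, S (S v)⟫ = (1 + m i)⁻¹ ⟪b i, v⟫`;
* `comp_self_apply_mem_domain_of_apply_basis` — `S (S v) ∈ D(A)` for every `v`
  (`m (1 + m)⁻¹ ∈ ℓ^∞`);
* `comp_self_add_diagonalPMap_of_apply_basis` — `S (S v) + A (S (S v)) = v` (`v ∈ H`);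
* `comp_self_apply_add_diagonalPMap_of_apply_basis` — `S (S (v + A v)) = v` (`v ∈ D(A)`);
* `resolvent_comp_self_of_eq_diagonalPMap` — the two identities packaged for any operator `A`
  EQUAL to `b.diagonalPMap m` (the form `Torus.stokesOperatorH d = b.diagonalPMap m` of
  `Torus.exists_hilbertBasis_stokes_holds`), and its instance `Torus.stokes_resolvent_comp_self`
  for the Stokes operator on the energy space of the flat torus `T^d`.

All of this is the functional calculus of the self-adjoint multiplication operator `diag(m)` on
`ℓ²(ι)` (Reed–Simon I, §VIII.3 Proposition 1, Thm. VIII.4–VIII.6: `(1 + m)^{-1/2}(A)² = (1 + A)⁻¹`;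
Constantin–Foias 1988, Ch. 4 (4.11)–(4.13) for the Stokes operator: `f(A) w_j = f(λ_j) w_j`),
coefficientwise the identity `(1 + m)(1 + m)^{-1/2}(1 + m)^{-1/2} = 1`.  Theorem-only; no
definitions, no named facts.  Deliberately NOT here: uniqueness of `S` itself, compactness,
anything at `m i < 0`.

## References

* M. Reed, B. Simon, *Methods of Modern Mathematical Physics I* (Academic Press, 1980), §VIII.3.
  [ReedSimonI1980]
* P. Constantin, C. Foias, *Navier–Stokes Equations* (Univ. Chicago Press, 1988), Ch. 4,
  (4.4)–(4.7), (4.11)–(4.13). [ConstantinFoiasNSE1988]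
-/

noncomputable section

open Filter
open scoped InnerProductSpace ENNReal

namespace Literature.Analysis.FluidPDE

section Diagonal

variable {ι H : Type*} [NormedAddCommGroup H] [InnerProductSpace ℝ H] [CompleteSpace H]
  (b : HilbertBasis ι ℝ H) {m : ι → ℝ} {S : H →L[ℝ] H}

/-- **Coordinates of `S ∘ S` for a frame operator pinned on the basis**: if
`S (b i) = (1 + m i)^{-1/2} b i` with `0 ≤ m i`, then `⟪b i, S (S v)⟫ = (1 + m i)⁻¹ ⟪b i, v⟫`
(`(1 + m)^{-1/2} (1 + m)^{-1/2} = (1 + m)⁻¹`; Halmos, *A Hilbert Space Problem Book*, Problems 61–62).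
[folklore] -/
theorem repr_comp_self_apply_of_apply_basis (hpos : ∀ i, 0 ≤ m i)
    (hS : ∀ i, S (b i) = ((1 + m i) ^ (-(1 / 2 : ℝ))) • b i) (v : H) (i : ι) :
    b.repr (S.comp S v) i = (1 + m i)⁻¹ * b.repr v i := by
  have hm0 : 0 < 1 + m i := add_pos_of_pos_of_nonneg one_pos (hpos i)
  rw [ContinuousLinearMap.comp_apply, Torus.repr_apply_of_apply_basis b _ S hS,
    Torus.repr_apply_of_apply_basis b _ S hS, ← mul_assoc, ← Real.rpow_add hm0,
    ← Real.rpow_neg_one (1 + m i)]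
  norm_num

/-- **`S ∘ S` maps into the domain of `A = diag(m)`**: if `S (b i) = (1 + m i)^{-1/2} b i` with
`0 ≤ m i`, then `S (S v) ∈ D(b.diagonalPMap m)` for every `v` — the coordinate sequence
`m (1 + m)⁻¹ ⟪b ·, v⟫` is square-summable because `0 ≤ m (1 + m)⁻¹ ≤ 1` (Reed–Simon I, §VIII.3
Proposition 1: the maximal domain of a multiplication operator). [folklore] -/
theorem comp_self_apply_mem_domain_of_apply_basis (hpos : ∀ i, 0 ≤ m i)
    (hS : ∀ i, S (b i) = ((1 + m i) ^ (-(1 / 2 : ℝ))) • b i) (v : H) :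
    S.comp S v ∈ (b.diagonalPMap m).domain := by
  have hm0 : ∀ i, 0 < 1 + m i := fun i => add_pos_of_pos_of_nonneg one_pos (hpos i)
  -- the symbol `m i * (1 + m i)⁻¹ ∈ [0, 1)` of `diag(m) ∘ (S ∘ S)`
  have hmr : Memℓp (fun i => m i * (1 + m i)⁻¹) ∞ := by
    refine memℓp_infty ⟨1, ?_⟩
    rintro _ ⟨i, rfl⟩
    dsimp only
    rw [Real.norm_of_nonneg (mul_nonneg (hpos i) (inv_pos.2 (hm0 i)).le), ← div_eq_mul_inv,
      div_le_one (hm0 i)]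
    exact le_add_of_nonneg_left zero_le_one
  rw [HilbertBasis.diagonalPMap_domain, HilbertBasis.mem_diagonalDomain_iff]
  refine (congrArg (Memℓp · 2) (funext fun i => ?_)).mp
    (hmr.infty_mul_left (lp.memℓp (b.repr v)))
  dsimp only
  rw [repr_comp_self_apply_of_apply_basis b hpos hS, mul_assoc]

/-- **First resolvent identity `(1 + A) (S ∘ S) = 1`**: if `S (b i) = (1 + m i)^{-1/2} b i` with
`0 ≤ m i`, then `S (S v) + diag(m) (S (S v)) = v` for every `v ∈ H` (coefficientwise
`(1 + m) (1 + m)⁻¹ c = c`; Reed–Simon I, Thm. VIII.5 (functional calculus); Constantin–Foias 1988,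
Ch. 4 (4.11)–(4.13)). [folklore] -/
theorem comp_self_add_diagonalPMap_of_apply_basis (hpos : ∀ i, 0 ≤ m i)
    (hS : ∀ i, S (b i) = ((1 + m i) ^ (-(1 / 2 : ℝ))) • b i) (v : H)
    (hv : S.comp S v ∈ (b.diagonalPMap m).domain) :
    S.comp S v + b.diagonalPMap m ⟨S.comp S v, hv⟩ = v := by
  have hm0 : ∀ i, 0 < 1 + m i := fun i => add_pos_of_pos_of_nonneg one_pos (hpos i)
  apply b.repr.injective
  ext i
  rw [map_add, lp.coeFn_add, Pi.add_apply, HilbertBasis.repr_diagonalPMap_apply]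
  change b.repr (S.comp S v) i + m i * b.repr (S.comp S v) i = b.repr v i
  rw [repr_comp_self_apply_of_apply_basis b hpos hS]
  calc (1 + m i)⁻¹ * b.repr v i + m i * ((1 + m i)⁻¹ * b.repr v i)
      = (1 + m i) * (1 + m i)⁻¹ * b.repr v i := by ring
    _ = b.repr v i := by rw [mul_inv_cancel₀ (hm0 i).ne', one_mul]

/-- **Second resolvent identity `(S ∘ S) (1 + A) = 1` on `D(A)`**: if
`S (b i) = (1 + m i)^{-1/2} b i` with `0 ≤ m i`, then `S (S (v + diag(m) v)) = v` for every
`v ∈ D(diag m)` (coefficientwise `(1 + m)⁻¹ (1 + m) c = c`; Reed–Simon I, Thm. VIII.5;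
Constantin–Foias 1988, Ch. 4 (4.11)–(4.13)). [folklore] -/
theorem comp_self_apply_add_diagonalPMap_of_apply_basis (hpos : ∀ i, 0 ≤ m i)
    (hS : ∀ i, S (b i) = ((1 + m i) ^ (-(1 / 2 : ℝ))) • b i) (v : H)
    (hv : v ∈ (b.diagonalPMap m).domain) :
    S.comp S (v + b.diagonalPMap m ⟨v, hv⟩) = v := by
  have hm0 : ∀ i, 0 < 1 + m i := fun i => add_pos_of_pos_of_nonneg one_pos (hpos i)
  apply b.repr.injective
  ext i
  rw [repr_comp_self_apply_of_apply_basis b hpos hS, map_add, lp.coeFn_add, Pi.add_apply,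
    HilbertBasis.repr_diagonalPMap_apply]
  change (1 + m i)⁻¹ * (b.repr v i + m i * b.repr v i) = b.repr v i
  calc (1 + m i)⁻¹ * (b.repr v i + m i * b.repr v i)
      = (1 + m i)⁻¹ * (1 + m i) * b.repr v i := by ring
    _ = b.repr v i := by rw [inv_mul_cancel₀ (hm0 i).ne', one_mul]

/-- **The resolvent `(1 + A)⁻¹ = S ∘ S` of an operator equal to a non-negative diagonal
operator.**  If `A = b.diagonalPMap m` (`0 ≤ m i`) and the bounded operator `S` acts on the basis
by `S (b i) = (1 + m i)^{-1/2} b i`, then `R := S ∘ S` maps `H` into `D(A)` with `R v + A (R v) = v`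
for every `v ∈ H`, and `R (v + A v) = v` for every `v ∈ D(A)`: `S ∘ S` is the two-sided inverse of
`1 + A` (Reed–Simon I, §VIII.3 Proposition 1 and Thm. VIII.4–VIII.6: `((1 + x)^{-1/2})²(A) =
(1 + A)⁻¹` for the self-adjoint multiplication operator `A`; Constantin–Foias 1988, Ch. 4
(4.11)–(4.13) for the Stokes operator).  Proof: `subst` and the coefficientwise identities above.
[cite: ReedSimonI1980, §VIII.3 Proposition 1, Thm. VIII.4–VIII.6] -/
theorem resolvent_comp_self_of_eq_diagonalPMap (hpos : ∀ i, 0 ≤ m i) {A : H →ₗ.[ℝ] H}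
    (hA : A = b.diagonalPMap m) (hS : ∀ i, S (b i) = ((1 + m i) ^ (-(1 / 2 : ℝ))) • b i) :
    (∀ v : H, ∃ hv : S.comp S v ∈ A.domain, S.comp S v + A ⟨S.comp S v, hv⟩ = v) ∧
      ∀ (v : H) (hv : v ∈ A.domain), S.comp S (v + A ⟨v, hv⟩) = v := by
  subst hA
  exact ⟨fun v => ⟨comp_self_apply_mem_domain_of_apply_basis b hpos hS v,
    comp_self_add_diagonalPMap_of_apply_basis b hpos hS v _⟩,
    fun v hv => comp_self_apply_add_diagonalPMap_of_apply_basis b hpos hS v hv⟩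

end Diagonal

/-! ### The Stokes operator on the torus -/

namespace Torus

/-- **The Stokes resolvent `(1 + A)⁻¹ = S ∘ S` from the action of `S` on a Stokes eigenbasis.**
For the Stokes operator `A = Torus.stokesOperatorH d` on the energy space `H` of the flat torus
`T^d`, presented by an eigenbasis `b` with non-negative symbol `m` (`A = b.diagonalPMap m`,
`Torus.exists_hilbertBasis_stokes_holds`), and any bounded `S` with `S (b i) = (1 + m i)^{-1/2} b i`:
`S (S v) ∈ D(A)` with `S (S v) + A (S (S v)) = v` for every `v ∈ H`, and `S (S (v + A v)) = v` for
every `v ∈ D(A)` (Constantin–Foias 1988, Ch. 4, (4.4)–(4.7), (4.11)–(4.13): `A` positive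
self-adjoint with compact inverse, functions of `A` act diagonally on the eigenfunctions `w_j`).
[cite: ConstantinFoiasNSE1988, Ch. 4 (4.4)–(4.7), (4.11)–(4.13)] -/
theorem stokes_resolvent_comp_self {d : Type*} [Fintype d] [DecidableEq d] {ι : Type*}
    (b : HilbertBasis ι ℝ (FunctionSpaces.Torus.energySpace d)) {m : ι → ℝ}
    (hpos : ∀ i, 0 ≤ m i) (hA : stokesOperatorH d = b.diagonalPMap m)
    {S : FunctionSpaces.Torus.energySpace d →L[ℝ] FunctionSpaces.Torus.energySpace d}
    (hS : ∀ i, S (b i) = ((1 + m i) ^ (-(1 / 2 : ℝ))) • b i) :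
    (∀ v : FunctionSpaces.Torus.energySpace d, ∃ hv : S.comp S v ∈ (stokesOperatorH d).domain,
        S.comp S v + stokesOperatorH d ⟨S.comp S v, hv⟩ = v) ∧
      ∀ (v : FunctionSpaces.Torus.energySpace d) (hv : v ∈ (stokesOperatorH d).domain),
        S.comp S (v + stokesOperatorH d ⟨v, hv⟩) = v :=
  resolvent_comp_self_of_eq_diagonalPMap b hpos hA hS

end Torus

end Literature.Analysis.FluidPDE

end
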